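import Literature.NumberTheory.DiophantineGeometry.AbelianSchemeModelReduction
import Literature.NumberTheory.DiophantineGeometry.OrdinaryFiltrationOfIsotropyProofs
import Literature.NumberTheory.DiophantineGeometry.WeilPairingRationalTateModule
import HarnessLib

/-!
# `ordinaryReduction_tateModule_filtration` from the Weil pairing and the isotropy of the kernel of reduction

Final glue for the named fact `ordinaryReduction_tateModule_filtration` (Greenberg 1991, §2):
combining the reduction datum of an abelian-scheme model (`AbelianSchemeModelReduction.lean`:
`red_v = IsAbelianSchemeModel.specialFibreReductionHom`, `Γ_{K_v}`-equivariant along `res`,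
inertia trivial, ordinary torsion counts) with the assembly without torsion lifting
(`OrdinaryFiltrationOfIsotropyProofs.lean`), the fact is reduced to exactly two inputs:

* the Weil pairing on `V_p B` as a non-degenerate `χ_p`-similitude form — the tree's named fact
  `weilPairing_rationalTateModule` (Milne 1986, §16), and
* for every abelian-scheme model with ordinary special fibre at `v ∣ p`, the **isotropy of
  `ker V_p(red_v)`** for such a form (the kernel of reduction is the Cartier dual of the étale
  quotient: Shatz 1986, §6–§7) — stated here as a hypothesis, not as a fact.

## References
* [Greenberg1991] R. Greenberg, *Iwasawa theory for motives*, §2 (p. 214).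
-/

noncomputable section

open scoped AddSubgroup TensorProduct NumberField
open CategoryTheory Field IsDedekindDomain IsDedekindDomain.HeightOneSpectrum
open Literature.NumberTheory.GaloisRepresentations Literature.NumberTheory.EllipticCurves
open Literature.AlgebraicGeometry.Motives (AbelianVariety SchemeOver)

namespace Literature.NumberTheory.DiophantineGeometry

variable {K : Type} [Field K] [NumberField K] {v : HeightOneSpectrum (𝓞 K)}
  {B : AbelianVariety K} {𝒜 : SchemeOver (valuationSubringAtPrime K v)} [GrpObj 𝒜]

/-- **The ordinary filtration from a model, given a Weil-type form and isotropy** (no torsion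
lifting): for an abelian-scheme model `𝒜` of `B` at `v ∣ p` with ordinary special fibre, a
non-degenerate `χ_p`-similitude form `e` on `V_p B` and the isotropy of `ker V_p(red_v)`,
`W = ker V_p(red_v)` satisfies the four clauses of `ordinaryReduction_tateModule_filtration`.
[cite: Greenberg1991, §2 (p. 214)] -/
theorem IsAbelianSchemeModel.exists_ordinaryFiltration' (h : IsAbelianSchemeModel B v 𝒜)
    (p : ℕ) [Fact p.Prime] (hpv : ((p : ℕ) : 𝓞 K) ∈ v.asIdeal)
    (hord : specialFibrePTorsionCard v 𝒜 = residueChar v ^ B.dim)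
    (e : LinearMap.BilinForm ℚ_[p] (B.rationalTateModule p)) (he : e.Nondegenerate)
    (heq : ∀ (g : absoluteGaloisGroup K) (x y : B.rationalTateModule p),
      e (B.rationalTateRep p g x) (B.rationalTateRep p g y) =
        (((GaloisRep.cyclotomicCharacter K p g : ℤ_[p]ˣ) : ℤ_[p]) : ℚ_[p]) * e x y)
    (hiso : ∀ x y : B.rationalTateModule p,
      (TateModule.map p h.specialFibreReductionHom).baseChange ℚ_[p] x = 0 →
        (TateModule.map p h.specialFibreReductionHom).baseChange ℚ_[p] y = 0 → e x y = 0) :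
    ∃ W : Submodule ℚ_[p] (B.rationalTateModule p),
      Module.finrank ℚ_[p] W = B.dim ∧
      (∀ (τ : absoluteGaloisGroup (v.adicCompletion K)), ∀ w ∈ W,
          B.rationalTateRep p (absGaloisRestrict K (v.adicCompletion K) τ) w ∈ W) ∧
      (∀ τ ∈ absInertia (v.adicCompletion K), ∀ w ∈ W,
          B.rationalTateRep p (absGaloisRestrict K (v.adicCompletion K) τ) w =
            (((GaloisRep.cyclotomicCharacter (v.adicCompletion K) p τ : ℤ_[p]ˣ) : ℤ_[p]) :
              ℚ_[p]) • w) ∧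
      (∀ τ ∈ absInertia (v.adicCompletion K), ∀ x : B.rationalTateModule p,
          B.rationalTateRep p (absGaloisRestrict K (v.adicCompletion K) τ) x - x ∈ W) := by
  letI := h.specialFibreGeomPointsAction
  exact exists_ordinaryFiltration_of_reduction_of_isotropic B v p h.specialFibreReductionHom
    h.specialFibreReductionHom_smul
    (fun _ hτ y ↦ h.specialFibreGeomPoints_smul_eq_self_of_mem_absInertia hτ y)
    (h.natCard_geomTorsion_specialFibre_pow hpv hord) e he heq hiso

/-- **`ordinaryReduction_tateModule_filtration` from the Weil pairing and isotropy.**  The named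
fact follows from (1) the tree's fact `weilPairing_rationalTateModule` (Weil pairing on `V_p B`,
Milne 1986 §16) and (2) the isotropy of the kernel of reduction `ker V_p(red_v)` for every
abelian-scheme model with ordinary special fibre at `v ∣ p` and every `χ_p`-similitude form
(Shatz 1986, §6–§7: the kernel of reduction is of multiplicative type).  Everything else — the
reduction map, its Galois equivariance, the triviality of inertia on the special fibre, the
ordinary torsion counts, the Galois-theoretic assembly — is proved in the tree.
[cite: Greenberg1991, §2 (p. 214)] -/
theorem ordinaryReduction_tateModule_filtration_of_isotropy
    (hW : weilPairing_rationalTateModule)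
    (hiso : ∀ {K : Type} [Field K] [NumberField K] (B : AbelianVariety K)
      (v : HeightOneSpectrum (𝓞 K)) (p : ℕ) [Fact p.Prime]
      (𝒜 : SchemeOver (valuationSubringAtPrime K v)) (_ : GrpObj 𝒜)
      (h : IsAbelianSchemeModel B v 𝒜),
      ((p : ℕ) : 𝓞 K) ∈ v.asIdeal → specialFibrePTorsionCard v 𝒜 = residueChar v ^ B.dim →
      ∀ e : LinearMap.BilinForm ℚ_[p] (B.rationalTateModule p),
        (∀ (g : absoluteGaloisGroup K) (x y : B.rationalTateModule p),
            e (B.rationalTateRep p g x) (B.rationalTateRep p g y) =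
              (((GaloisRep.cyclotomicCharacter K p g : ℤ_[p]ˣ) : ℤ_[p]) : ℚ_[p]) * e x y) →
        ∀ x y : B.rationalTateModule p,
          (TateModule.map p h.specialFibreReductionHom).baseChange ℚ_[p] x = 0 →
            (TateModule.map p h.specialFibreReductionHom).baseChange ℚ_[p] y = 0 → e x y = 0) :
    ordinaryReduction_tateModule_filtration := by
  intro K _ _ B v p _ hpv hord
  obtain ⟨𝒜, inst, h, hcard⟩ := hord
  haveI : NeZero (p : K) := ⟨Nat.cast_ne_zero.mpr (Fact.out : p.Prime).ne_zero⟩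
  obtain ⟨e, -, he, heq⟩ := hW B p (NeZero.ne _)
  exact h.exists_ordinaryFiltration' p hpv hcard e he heq (hiso B v p 𝒜 inst h hpv hcard e heq)

end Literature.NumberTheory.DiophantineGeometry
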